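import Mathlib
import HarnessLib
import Summits.ValiantsHypothesis.ValiantsHypothesis.Theses.MonotoneRestoration
import Literature.Computability.AlgebraicComplexity.ArithCircuit
import Literature.Computability.AlgebraicComplexity.ArithCircuitProofs
import Literature.Computability.AlgebraicComplexity.MonotoneStructure
import Literature.Computability.AlgebraicComplexity.PermanentIrreducible
import Literature.ModelTheory.FiniteModelTheory.CkEquiv
import Summits.ValiantsHypothesis.ValiantsHypothesis.Theorems.MonotoneRestorationMonotoneRestorationQPCosetCount
import Summits.ValiantsHypothesis.ValiantsHypothesis.Theorems.MonotoneRestorationMonotoneRestorationQPSymmetricLB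
import Summits.ValiantsHypothesis.ValiantsHypothesis.Theorems.MonotoneRestorationMonotoneRestorationQPSupportSymmetrisation
import Summits.ValiantsHypothesis.ValiantsHypothesis.Theorems.MonotoneRestorationMonotoneRestorationQPSparseRegime
import Summits.ValiantsHypothesis.ValiantsHypothesis.Theorems.MonotoneRestorationMonotoneRestorationQPBeta
import Literature.Computability.AlgebraicComplexity.SymmetricArithCircuit
import Literature.Computability.AlgebraicComplexity.DawarWilsenach2025Proofs
import Literature.GroupTheory.PermutationGroups.SmallIndexSubgroups
import Summits.ValiantsHypothesis.ValiantsHypothesis.Theorems.MonotoneRestorationQP.Negative.LoadBearing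
import Summits.ValiantsHypothesis.ValiantsHypothesis.Theorems.MonotoneRestorationMonotoneRestorationQPPermSupportCount
import Literature.Barriers.ValiantsHypothesis.MonotoneGapDecomposition

/-! TTRL-lite variant V19960 of stmt-ValiantsHypothesis-15886 -/

-- `Summit.ValiantsHypothesis.ValiantsHypothesis.…` is the tree's mandated single-conjunct layout
-- (Sub = Summit), so the duplicated namespace component is intended.
set_option linter.dupNamespace false

namespace Summit.ValiantsHypothesis.ValiantsHypothesis.Theorems

open Summit.ValiantsHypothesis.ValiantsHypothesis.Theses.MonotoneRestoration
open Literature.Computability.AlgebraicComplexity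

/-- **TTRL-lite variant V19960** (`lemma_proposal`) of `stub_monotoneComputation_of_complexity`
(item `stmt-ValiantsHypothesis-15886`): structure of `⊗`-free computations (Jerrum–Snir
`⊗`-complexity `0`). A monotone computation (plain fan-in-two circuit over `ℝ≥0`) with no product
gate computes only polynomials of total degree `≤ 1`: every gate is a plain sum, so every gate
value is an `ℕ`-combination of variables plus a constant. Formally this is the base case of the
tree's Jerrum–Snir descent: if `1 < deg f`, the output operand refers to a gate of degree `> 1`
(`exists_gate_of_lt_totalDegree_operand`), below which the descent
`exists_prodGate_of_lt_totalDegree` finds a product gate, contradicting `prodCount P = 0`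
(`prodCount_zeroAt_succ`). [cite: JerrumSnir1982, §2.2 and §3.3] -/
theorem stub_monotoneComputation_of_complexity_var19960 :
    ∀ (σ : Type) (P : ArithCircuit NNReal σ) (f : MvPolynomial σ NNReal),
      Literature.Barriers.ValiantsHypothesis.IsMonotoneComputation P f →
      Literature.Barriers.ValiantsHypothesis.prodCount P = 0 → f.totalDegree ≤ 1 := by
  intro σ P f hP hcount
  obtain ⟨h2, -, hf⟩ := hP
  have hf' : P.eval = f := hf
  subst hf'
  refine le_of_not_gt fun hdeg => ?_
  obtain ⟨j, -, hj⟩ :=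
    Literature.Barriers.ValiantsHypothesis.exists_gate_of_lt_totalDegree_operand
      (ArithCircuit.gateValues P.gates) le_rfl P.output hdeg
  obtain ⟨v, args, -, hv, -, -⟩ :=
    Literature.Barriers.ValiantsHypothesis.exists_prodGate_of_lt_totalDegree P.gates h2 le_rfl j hj
  have hsucc := Literature.Barriers.ValiantsHypothesis.prodCount_zeroAt_succ hv
  omega

end Summit.ValiantsHypothesis.ValiantsHypothesis.Theorems
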